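import Literature.MathematicalPhysics.QuantumFieldTheory.ConformalBootstrap3D.PointKernelK34v2Data
import Literature.MathematicalPhysics.QuantumFieldTheory.ConformalBootstrap3D.PointKernelParts

/-!
# K34v2 certificate, kernel part file P8: one-cell head segments 100, 101 in level ranges

The head cells whose kernel evaluation exceeds one `decide` are one-cell segments of `hsegsK34v2`; each is
checked by `PCert.hPartSideOK` (side conditions) and `PCert.hPartOK` per level range `[n_lo, n_lo + count)`
against an integer claim, the claims summing to `≥ 0` (`PointKernel.partsOK`); soundness is
`PCert.hParts_sound` (`PointKernelParts`).  The part files `P1, P2, …` are mutually independent (each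
imports only the data file); the ranges of one cell may span several of them, and the per-cell
conclusions `hparts_i` / `hcell_i` of those cells are assembled in `PointKernelK34v2.lean`.
Estimated kernel time 241 s.
-/

set_option maxRecDepth 100000
set_option maxHeartbeats 0

namespace Literature.MathematicalPhysics.QuantumFieldTheory.ConformalBootstrap3D.PointKernelK34v2

open Literature.MathematicalPhysics.QuantumFieldTheory.ConformalBootstrap3D.PointKernel

/-- levels `[31, 43)` of segment 100: partial lower sum `≥` claim. [folklore] -/
theorem part_100_1 : certK34v2.hPartOK (PCert.segAt hsegsK34v2 100) JHK34v2 31 12 (2214396909509204760790406609998298590) = true := by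
  decide +kernel

/-- levels `[43, 52)` of segment 100: partial lower sum `≥` claim. [folklore] -/
theorem part_100_2 : certK34v2.hPartOK (PCert.segAt hsegsK34v2 100) JHK34v2 43 9 (512141347082374247594983966218382358) = true := by
  decide +kernel

/-- levels `[52, 59)` of segment 100: partial lower sum `≥` claim. [folklore] -/
theorem part_100_3 : certK34v2.hPartOK (PCert.segAt hsegsK34v2 100) JHK34v2 52 7 (135581079490668022536646009354990836) = true := by
  decide +kernel

/-- one-cell segment 101 (row 4, cell `[5123/1024, 1281/256]`, chord, `n_F = 50`,
3 level ranges): side conditions. [folklore] -/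
theorem pside_101 : certK34v2.hPartSideOK (PCert.segAt hsegsK34v2 101) JHK34v2 = true := by
  decide +kernel

/-- its level ranges `(n_lo, count, claim)`. [folklore] -/
def parts_101 : List (ℕ × ℕ × ℤ) := [(0, 32, -2415638330357912252370146716546438357), (32, 13, 2102968699366344898484283256391005773), (45, 6, 312669630991567353885863460155432584)]

/-- the ranges tile `[0, n_F]` and the claims sum to `≥ 0`. [folklore] -/
theorem pcov_101 : PointKernel.partsOK 50 parts_101 = true := by
  decide +kernel

/-- levels `[0, 32)` of segment 101: partial lower sum `≥` claim. [folklore] -/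
theorem part_101_0 : certK34v2.hPartOK (PCert.segAt hsegsK34v2 101) JHK34v2 0 32 (-2415638330357912252370146716546438357) = true := by
  decide +kernel

end Literature.MathematicalPhysics.QuantumFieldTheory.ConformalBootstrap3D.PointKernelK34v2
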